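import Literature.MathematicalPhysics.QuantumLattice.HubbardSectorPhaseSpaceCount
import Literature.MathematicalPhysics.QuantumLattice.HubbardEffectiveActionCT
import HarnessLib

/-!
# The phase-space sum of ONE Salmhofer slice of a frequency–momentum cutoff: `sup × count`, `κ_Λ² ≲ Λ′²/Λ` per `βL²`
# (Benfatto–Giuliani–Mastropietro 2006, (2.80), for a general band given a density-of-states count)

Topic `MathematicalPhysics/QuantumLattice`; companion of `InfraredCutoffGramConstant.lean` (the infrared REMAINDER `1 - w_Λ`
of the scale-`0` step, de Siqueira Pedra–Salmhofer 2008 Lemma 5.1) and of `HubbardShiftedSliceGram.lean` /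
`HubbardGridSliceGram.lean` (single slices of the FREE band `ε - μ`, counted by `TorusShellCounting.card_torusShell_le`).
Here: a single SLICE `w_Λ - w_{Λ′}`, `w_Λ(k) = χ₂((ω² + e(k⃗)²)/Λ²)` (`salmhoferCutoff`, Salmhofer 1999 (4.70)), of an
ARBITRARY band `e : (ℤ/Lℤ)² → ℝ` — the moving frames `e_K = ε - μ - K` of a counterterm flow — given only the level count
`#{k⃗ : |e(k⃗)| < Λ′} ≤ c₁Λ′L² + c₂L` (for admissible frames: `TorusShellCountRegularBand` /
`Theorems/KLProgrammeKLRegimeFrameShellCount.card_frameLevel_lt_le`, `(c₁, c₂) = (1793, 704)`, every `L ≥ 1`).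
The Fourier–Gram constant of the slice propagator `(w_Λ - w_{Λ′})/(-iω + e)` is `(βL²)⁻¹` times the phase-space sum bounded
here (BGM 2006 (2.80): "the Gram constant of a single-scale propagator is the sup of its symbol times the phase-space
count of its support"):

* `sliceCutoff_eq_zero_of_le`, `sliceCutoff_eq_zero_of_ge`, `support_sliceCutoff`, `abs_sliceCutoff_le_one` — the slice
  weight lives on the shell `Λ²/4 < ω² + e² < Λ′²` and is bounded by `1`;
* **`sum_sliceCutoff_div_sqrt_le`** — for `0 < β`, `0 < Λ ≤ Λ′` and the count at level `Λ′`: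
  `Σ_{(i,k⃗)} |χ₂((ω_i² + e²)/Λ²) - χ₂((ω_i² + e²)/Λ′²)| / √(ω_i² + e²) ≤ (2/Λ)·(Λ′β/π + 3)·(c₁Λ′L² + c₂L)`, uniformly in
  the Matsubara cutoff `M` (sup `2/Λ` on the shell × `#{|ω_i| < Λ′}·#{|e| < Λ′}`); at `Λ′ = 4Λ` and `β, L ≳ 1/Λ` this is
  `≲ Λ·βL²`, i.e. `κ_Λ² ≲ Λ` — the single-scale power-counting factor;
* **`sum_sliceWeightCT_div_sqrt_le`** — the instance `e = e_K = nambuXiCT L μ K` (the weights `hubbardCutoffWeightCT`).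

Everything is PROVED; no definition, no named fact.

## References

* G. Benfatto, A. Giuliani, V. Mastropietro, Ann. Henri Poincaré 7 (2006) 809–898, §2.5 (2.50), §2.8 (2.80) and footnote 1.
  [BenfattoGiulianiMastropietro2006]
* M. Salmhofer, *Renormalization* (Springer 1999), §4.2.5 (4.70)–(4.71). [Salmhofer1999]
-/

noncomputable section

namespace Literature.MathematicalPhysics.QuantumLattice

open Finset Literature.Probability.LatticeModels

variable {L M : ℕ}

/-! ### The support of a slice of Salmhofer's cutoff -/

/-- Below both scales the slice weight vanishes: `x ≤ Λ²/4`, `Λ ≤ Λ′` ⇒ `χ₂(x/Λ²) - χ₂(x/Λ′²) = 0`.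
[cite: Salmhofer1999, §4.2.5 (4.71)] -/
theorem sliceCutoff_eq_zero_of_le {x Λ Λ' : ℝ} (hΛ : 0 < Λ) (hΛΛ' : Λ ≤ Λ') (hxΛ : x ≤ Λ ^ 2 / 4) :
    salmhoferCutoff (x / Λ ^ 2) - salmhoferCutoff (x / Λ' ^ 2) = 0 := by
  have hΛ' : 0 < Λ' := hΛ.trans_le hΛΛ'
  have hsq : Λ ^ 2 ≤ Λ' ^ 2 := pow_le_pow_left₀ hΛ.le hΛΛ' 2
  have h1 : salmhoferCutoff (x / Λ ^ 2) = 0 := by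
    refine salmhoferCutoff_of_le ?_
    rw [div_le_iff₀ (by positivity)]; linarith
  have h2 : salmhoferCutoff (x / Λ' ^ 2) = 0 := by
    refine salmhoferCutoff_of_le ?_
    rw [div_le_iff₀ (by positivity)]; nlinarith
  rw [h1, h2, sub_zero]

/-- Above both scales the slice weight vanishes: `Λ′² ≤ x`, `Λ ≤ Λ′` ⇒ `χ₂(x/Λ²) - χ₂(x/Λ′²) = 0`.
[cite: Salmhofer1999, §4.2.5 (4.71)] -/
theorem sliceCutoff_eq_zero_of_ge {x Λ Λ' : ℝ} (hΛ : 0 < Λ) (hΛΛ' : Λ ≤ Λ') (hxΛ : Λ' ^ 2 ≤ x) :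
    salmhoferCutoff (x / Λ ^ 2) - salmhoferCutoff (x / Λ' ^ 2) = 0 := by
  have hΛ' : 0 < Λ' := hΛ.trans_le hΛΛ'
  have hsq : Λ ^ 2 ≤ Λ' ^ 2 := pow_le_pow_left₀ hΛ.le hΛΛ' 2
  have h1 : salmhoferCutoff (x / Λ ^ 2) = 1 := by
    refine salmhoferCutoff_of_ge ?_
    rw [le_div_iff₀ (by positivity)]; linarith
  have h2 : salmhoferCutoff (x / Λ' ^ 2) = 1 := by
    refine salmhoferCutoff_of_ge ?_
    rw [le_div_iff₀ (by positivity)]; linarith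
  rw [h1, h2, sub_self]

/-- **The slice weight lives on the shell** `Λ²/4 < x < Λ′²` (`x = ω² + e²`). [cite: Salmhofer1999, §4.2.5 (4.70)] -/
theorem support_sliceCutoff {x Λ Λ' : ℝ} (hΛ : 0 < Λ) (hΛΛ' : Λ ≤ Λ')
    (h : salmhoferCutoff (x / Λ ^ 2) - salmhoferCutoff (x / Λ' ^ 2) ≠ 0) : Λ ^ 2 / 4 < x ∧ x < Λ' ^ 2 := by
  constructor
  · by_contra hc
    exact h (sliceCutoff_eq_zero_of_le hΛ hΛΛ' (not_lt.1 hc))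
  · by_contra hc
    exact h (sliceCutoff_eq_zero_of_ge hΛ hΛΛ' (not_lt.1 hc))

/-- The slice weight is bounded by `1` in absolute value (both cutoffs lie in `[0,1]`). [cite: Salmhofer1999, §4.2.5 (4.71)] -/
theorem abs_sliceCutoff_le_one (x Λ Λ' : ℝ) : |salmhoferCutoff (x / Λ ^ 2) - salmhoferCutoff (x / Λ' ^ 2)| ≤ 1 := by
  have h1 := salmhoferCutoff_mem_Icc (x / Λ ^ 2)
  have h2 := salmhoferCutoff_mem_Icc (x / Λ' ^ 2)
  rw [abs_le]
  constructor <;> linarith [h1.1, h1.2, h2.1, h2.2]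

/-! ### Sup × count -/

/-- **The phase-space sum of one slice is `sup × count`.**  For a band `e : (ℤ/Lℤ)² → ℝ` with the level count
`#{k⃗ : |e k⃗| < Λ′} ≤ c₁Λ′L² + c₂L`, `0 < β`, `0 < Λ ≤ Λ′`, and every Matsubara cutoff `M`:
`Σ_{(i,k⃗)} |χ₂((ω_i² + e²)/Λ²) - χ₂((ω_i² + e²)/Λ′²)| / √(ω_i² + e²) ≤ (2/Λ)·((Λ′β/π + 3)·(c₁Λ′L² + c₂L))`
(each summand vanishes off the shell `Λ²/4 < ω_i² + e² < Λ′²`, where it is `≤ 2/Λ`; the shell lies in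
`{|ω_i| < Λ′} × {|e| < Λ′}`, counted by `card_filter_matsubaraFreq_le` times the level count).
[cite: BenfattoGiulianiMastropietro2006, §2.8 (2.80)] -/
theorem sum_sliceCutoff_div_sqrt_le [NeZero L] {β : ℝ} (hβ : 0 < β) (e : TorusSite 2 L → ℝ) {Λ Λ' c₁ c₂ : ℝ}
    (hΛ : 0 < Λ) (hΛΛ' : Λ ≤ Λ') (hc₁ : 0 ≤ c₁) (hc₂ : 0 ≤ c₂)
    (hcount : (((univ : Finset (TorusSite 2 L)).filter fun k => |e k| < Λ').card : ℝ) ≤ c₁ * Λ' * (L : ℝ) ^ 2 + c₂ * L) :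
    ∑ k : FreqMomentum L M, |salmhoferCutoff ((matsubaraFreq β M k.1 ^ 2 + e k.2 ^ 2) / Λ ^ 2) -
          salmhoferCutoff ((matsubaraFreq β M k.1 ^ 2 + e k.2 ^ 2) / Λ' ^ 2)| /
        Real.sqrt (matsubaraFreq β M k.1 ^ 2 + e k.2 ^ 2) ≤
      2 / Λ * ((Λ' * β / Real.pi + 3) * (c₁ * Λ' * (L : ℝ) ^ 2 + c₂ * L)) := by
  classical
  have hΛ' : 0 < Λ' := hΛ.trans_le hΛΛ'
  have hL : (0 : ℝ) < L := by exact_mod_cast Nat.pos_of_ne_zero (NeZero.ne L)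
  -- the indicator of the box `{|ω| < Λ′} × {|e| < Λ′}`
  set ind : FreqMomentum L M → ℝ := fun k =>
    if |matsubaraFreq β M k.1| < Λ' ∧ |e k.2| < Λ' then 1 else 0 with hind
  -- pointwise majorant
  have hpt : ∀ k : FreqMomentum L M,
      |salmhoferCutoff ((matsubaraFreq β M k.1 ^ 2 + e k.2 ^ 2) / Λ ^ 2) -
            salmhoferCutoff ((matsubaraFreq β M k.1 ^ 2 + e k.2 ^ 2) / Λ' ^ 2)| /
          Real.sqrt (matsubaraFreq β M k.1 ^ 2 + e k.2 ^ 2) ≤ 2 / Λ * ind k := by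
    intro k
    set ω := matsubaraFreq β M k.1 with hω
    set ξ := e k.2 with hξ
    by_cases h0 : salmhoferCutoff ((ω ^ 2 + ξ ^ 2) / Λ ^ 2) - salmhoferCutoff ((ω ^ 2 + ξ ^ 2) / Λ' ^ 2) = 0
    · rw [h0, abs_zero, zero_div]
      have : 0 ≤ ind k := by simp only [hind]; split_ifs <;> norm_num
      positivity
    · obtain ⟨hlow, hup⟩ := support_sliceCutoff hΛ hΛΛ' h0
      have hωΛ : |ω| < Λ' := abs_lt_of_sq_lt_sq' (by nlinarith [sq_nonneg ξ] : ω ^ 2 < Λ' ^ 2) hΛ'.le |> abs_lt.2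
      have hξΛ : |ξ| < Λ' := abs_lt_of_sq_lt_sq' (by nlinarith [sq_nonneg ω] : ξ ^ 2 < Λ' ^ 2) hΛ'.le |> abs_lt.2
      have hind1 : ind k = 1 := by
        simp only [hind]
        rw [if_pos ⟨hωΛ, hξΛ⟩]
      have hsqrt : Λ / 2 ≤ Real.sqrt (ω ^ 2 + ξ ^ 2) := by
        rw [show Λ / 2 = Real.sqrt ((Λ / 2) ^ 2) by rw [Real.sqrt_sq (by positivity)]]
        exact Real.sqrt_le_sqrt (by linarith)
      have hs0 : 0 < Real.sqrt (ω ^ 2 + ξ ^ 2) := lt_of_lt_of_le (by positivity) hsqrt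
      rw [hind1, mul_one, div_le_div_iff₀ hs0 hΛ]
      have hw := abs_sliceCutoff_le_one (ω ^ 2 + ξ ^ 2) Λ Λ'
      have habs0 := abs_nonneg (salmhoferCutoff ((ω ^ 2 + ξ ^ 2) / Λ ^ 2) - salmhoferCutoff ((ω ^ 2 + ξ ^ 2) / Λ' ^ 2))
      nlinarith
  -- count the box
  have hcountω : ((((univ : Finset (MatsubaraIdx M)).filter fun i => |matsubaraFreq β M i| < Λ').card : ℕ) : ℝ) ≤
      Λ' * β / Real.pi + 3 :=
    card_filter_matsubaraFreq_le hβ hΛ'.le _ fun i hi => (mem_filter.1 hi).2.le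
  have hsumind : ∑ k : FreqMomentum L M, ind k =
      ((((univ : Finset (MatsubaraIdx M)).filter fun i => |matsubaraFreq β M i| < Λ').card : ℕ) : ℝ) *
        ((((univ : Finset (TorusSite 2 L)).filter fun k => |e k| < Λ').card : ℕ) : ℝ) := by
    simp only [hind]
    rw [sum_boole, ← Nat.cast_mul, ← card_filter_freqMomentum_eq]
  have hcnt0 : 0 ≤ c₁ * Λ' * (L : ℝ) ^ 2 + c₂ * L := by positivity
  calc ∑ k : FreqMomentum L M, |salmhoferCutoff ((matsubaraFreq β M k.1 ^ 2 + e k.2 ^ 2) / Λ ^ 2) -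
            salmhoferCutoff ((matsubaraFreq β M k.1 ^ 2 + e k.2 ^ 2) / Λ' ^ 2)| /
          Real.sqrt (matsubaraFreq β M k.1 ^ 2 + e k.2 ^ 2)
      ≤ ∑ k : FreqMomentum L M, 2 / Λ * ind k := sum_le_sum fun k _ => hpt k
    _ = 2 / Λ * ∑ k : FreqMomentum L M, ind k := by rw [mul_sum]
    _ ≤ 2 / Λ * ((Λ' * β / Real.pi + 3) * (c₁ * Λ' * (L : ℝ) ^ 2 + c₂ * L)) := by
        refine mul_le_mul_of_nonneg_left ?_ (by positivity)
        rw [hsumind]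
        exact mul_le_mul hcountω hcount (Nat.cast_nonneg _) (by positivity)

/-- **The instance `e = e_K`**: for the frame band `nambuXiCT L μ K` and the weights `w^K_Λ = hubbardCutoffWeightCT`, given the
level count `#{k⃗ : |e_K(k⃗)| < Λ′} ≤ c₁Λ′L² + c₂L`:
`Σ_{(ω,k⃗)} |w^K_Λ - w^K_{Λ′}| / √(ω² + e_K²) ≤ (2/Λ)·((Λ′β/π + 3)·(c₁Λ′L² + c₂L))` — `(βL²)` times the Fourier–Gram constant of
the slice `C^K_{(Λ,Λ′]}` of the counterterm-frame covariance. [cite: BenfattoGiulianiMastropietro2006, §2.8 (2.80)] -/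
theorem sum_sliceWeightCT_div_sqrt_le [NeZero L] {β : ℝ} (hβ : 0 < β) (μ : ℝ) (K : TrigPolyC4v) {Λ Λ' c₁ c₂ : ℝ}
    (hΛ : 0 < Λ) (hΛΛ' : Λ ≤ Λ') (hc₁ : 0 ≤ c₁) (hc₂ : 0 ≤ c₂)
    (hcount : (((univ : Finset (TorusSite 2 L)).filter fun k => |nambuXiCT L μ K k| < Λ').card : ℝ) ≤
      c₁ * Λ' * (L : ℝ) ^ 2 + c₂ * L) :
    ∑ k : FreqMomentum L M, |hubbardCutoffWeightCT L M β μ K Λ k - hubbardCutoffWeightCT L M β μ K Λ' k| /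
        Real.sqrt (matsubaraFreq β M k.1 ^ 2 + nambuXiCT L μ K k.2 ^ 2) ≤
      2 / Λ * ((Λ' * β / Real.pi + 3) * (c₁ * Λ' * (L : ℝ) ^ 2 + c₂ * L)) :=
  sum_sliceCutoff_div_sqrt_le hβ (nambuXiCT L μ K) hΛ hΛΛ' hc₁ hc₂ hcount

end Literature.MathematicalPhysics.QuantumLattice

end
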